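import Literature.MathematicalPhysics.QuantumFieldTheory.Balaban1983to89.Node00.CarriersB8SubBP2DPer
import Literature.MathematicalPhysics.QuantumFieldTheory.Balaban1983to89.Node00.CarriersB8SubDKappa

/-!
# NODE 00 (YM-PLAN Track A) — STAGE 3′(X.B8-P₂D-PER-κ): THE PERIODIC δ₂-GROUP OF RECORD **READ ON THE PRINT-CLASS CUT** `IdxB8SubDPerκ θ P M₁ R` (director-ym №220 (A-4) «+ its slot carrier»):
# the bundle substitution `withB8OfRecordSubBP₂DPerκ`, the surviving leaf `B8LeafOfRecordSubBP₂DPerκ` (shape `B8LeafRS`), the Stage-5 pin `pinB8SubBP₂DPerκ` (UP-SIDE), THE DOORS (c₁κ) ∕ (c₂κ)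
# to the display of record `B8LeafRS` at `upOfRecord₅CS`, and «UNCUT ⇒ CUT»

[Balaban1985RegularSpaces] = T. Bałaban, *Spaces of regular gauge field configurations on a lattice and gauge fixing conditions*, Commun. Math. Phys. **99** (1985) 75–102 — (1.3)–(1.4) p. 77
(«Ω_j is a sum of cubes of a size M₁Lʲη, (Lʲη)⁻¹dist(Ω_jᶜ, Ω_{j+1}) > RM₁»; «M₁ … fixed in [4]»), p. 77 («Ω_j ⊂ T_η»), Lemma 1 p. 79 – Thm 8 p. 101.  [Balaban1984PropagatorsII] (2.2)
p. 224.  [Balaban1987RG1] (0.1) p. 251 (the torus).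

NODE 00 CARRIER MODULE (width seat `pub-ymgap-dag-n05-w1` g4, 2026-08-28 — the κ-TWIN (K2) of this seat's P2′ `Node00/CarriersB8SubBP2DPer` for director-ym №220 (A-4) and dag-n05-d's
«P4 κ-CUT FROM BIRTH» (P4 ACK 14:38Z: «index `IdxB8SubD ↦ IdxB8SubDPerκ θ P M₁ R`, member `zdGF3HP₂Per`, binders at the ONE pinned block size `M₁`»).  P2′ §1–§3 VERBATIM with the
index `IdxB8SubDPer θ P ↦ IdxB8SubDPerκ θ P M₁ R` read THROUGH `Subtype.val` — NO new family (the members are P2′'s `famB8OfRecordSubBP₂DPer θ β len P j.1`), NO new residual layer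
(`CarriersB8Per.ResidB8Per θ P`, axial slot `lam.toAxial j.1`); APPEND-ONLY: a NEW importing module — P2′, K1 `Node00/CarriersB8SubDKappa` (`IdxB8SubDPerκ`, non-vacuity),
`CarriersB8Per` (`ResidB8Per`, `upOfRecord₅CS_b8_iff_of_res_X_eq'`) CONSUMED BY NAME, nothing edited; no rung text touched (HARD FREEZE №216 (f); the edition A-5 is plan's, on trigger).

WHAT IS PINNED.  At `θ.pinB8SubBP₂DPerκ P M₁ R lam` the [B8] group of every run's carrier bundle IS (`PrintedCarriersR.withB8OfRecordSubBP₂DPerκ`): index `I8b := IdxB8SubDPerκ θ P M₁ R`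
(periodic (1.5)-members IN PRINT's (1.3)–(1.4) CLASS at the pinned `(M₁, R)`), family `fun j => famB8OfRecordSubBP₂DPer θ β len P j.1` (P1′'s `zdGF3HP₂Per` at `j.1.toZdIdx`), `proj140`
PROVED (P2′), Lemma-1 carriers `blockPairNA`, constants ∕ Prop-5 ∕ Prop-6 carriers from `lam.base : ResidB8 θ` (the chain's cuts `cutSubBP₅ …` apply verbatim), axial slot `lam.toAxial j.1`
(FREE — the display's `p7` slot); every other group unchanged (`rfl`); UP-SIDE (`datumOfRecord₅_pinB8SubBP₂DPerκ`); commutes with the [B10] ∕ Y ∕ Z ∕ W pins; supersedes the ℤᵈ ∕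
periodic ∕ P₂D ∕ P₂D-periodic pins (`rfl` ×4).

THE DOORS.  (c₁κ) `upOfRecord₅CS_pinB8SubBP₂DPerκ_b8_iff` (`Iff.rfl`); (c₂κ) `upOfRecord₅CS_b8_iff_of_res_X_eq_subBP₂DPerκ` (equation-keyed, any Stage-5 parameters — the Stage-13 view
`θ'.toStage5₁₃CoPH F 2` included; `CarriersB8Per.upOfRecord₅CS_b8_iff_of_res_X_eq'` BY NAME).  «UNCUT ⇒ CUT»: ★ `b8LeafOfRecordSubBP₂DPerκ_of_subBP₂DPer` (P2′'s `_subtype` door at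
`Q := Admissible134 …`) — under Q-SG1 = «EXCLUDED-BY-CUT» the two slots are interchangeable for a discharge, under «SURVIVES» the κ-slot is the one a statement edition can point at.
§3: sub-family doors of the κ-slot, the projections `_t2 ∕ _t4 ∕ _t8 ∕ _p3`, and NON-VACUITY of the pinned index (`nonempty_I8b_withB8OfRecordSubBP₂DPerκ`, K1 BY NAME).

HONEST FRAMING: definitions + kernel bookkeeping (`rfl` ∕ `Iff.rfl` ∕ one induction ∕ restriction along `Subtype.val`); NO estimate; the leaf `B8LeafOfRecordSubBP₂DPerκ` is a PROPOSITION
(N05's display over print-class periodic δ₂-members), NOT proved here; FLAG №10 NOT closed by a definition; N05 NOT discharged (№217 (1)(b), (2): judged at this display with the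
`c₁ ∕ ρ₀` guard carried); counts unmoved; one finite T⁴ programme at fixed ε, Bałaban AS PRINTED — NOT continuum ∕ ℝ⁴ ∕ OS ∕ mass gap ∕ Clay.  No `sorry`, no `axiom`, no `instance`,
no `notation`. -/

noncomputable section

namespace Literature.MathematicalPhysics.QuantumFieldTheory.Balaban1983to89.Node00

open T4Continuum AveragingRT T4FiniteEpsInhabited FlowStep FlowStepRuns DagBinding T4DatumAssembly
open B8LeafKnitRS (B8LeafRS)
open B8LeafModelZd (ZdIdx)
open B8LeafModelZd3P2 (zdGF3P₂ zdGF3HP₂)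
open B8LeafModelZdHP2Per (zdGF3HP₂Per)
open B8TowerBondsPrinted (towerBondsP)
open B9SupplySockB9P3ZdGammaUnivDelta2 (SockB9P3H2)
open B8Eq134Admissible (Admissible134)
open B8Lemma1NonAbelian (blockPairNA)
open scoped Matrix.Norms.L2Operator

/-! ## §1. The periodic δ₂-group of record read on the cut index: bundle substitution, the κ-leaf, `rfl` faces -/

section Bundle

variable {θ : Stage3Params} {P M₁ R : ℕ}

/-- The cut family's member IS P1′'s periodic δ₂-model at the member's geometry (`rfl`). [cite: Balaban1985RegularSpaces, (1.29) p.81, (1.3)–(1.4) p.77 (bookkeeping)] -/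
theorem famB8OfRecordSubBP₂DPer_kappa_eq (β : ℝ) (len : B7Prop1Explicit.Site θ.D → ℝ) (j : IdxB8SubDPerκ θ P M₁ R) :
    famB8OfRecordSubBP₂DPer θ β len P j.1 = zdGF3HP₂Per θ.𝔸 θ.L β len j.toZdIdx P := rfl

/-- **THE PERIODIC δ₂-GROUP OF RECORD ON THE PRINT-CLASS CUT substituted into a carrier bundle** `X`: index `IdxB8SubDPerκ θ P M₁ R`, family `famB8OfRecordSubBP₂DPer θ β len P ∘ Subtype.val`,
`proj140` proved (P2′), Lemma-1 carriers `blockPairNA`, constants and Prop-5 ∕ Prop-6 carriers from `lam.base`, axial slot `lam.toAxial ∘ val` (FREE residual data); every other group of `X`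
unchanged. [cite: Balaban1985RegularSpaces, Lemma 1 p.79 – Thm 8 p.101 (the carriers of the typed statements); (1.3)–(1.4) p.77; p.77 («Ω_j ⊂ T_η»)] -/
def _root_.Literature.MathematicalPhysics.QuantumFieldTheory.Balaban1983to89.DagBinding.PrintedCarriersR.withB8OfRecordSubBP₂DPerκ (X : PrintedCarriersR)
    (θ : Stage3Params) (P M₁ R : ℕ) (lam : ResidB8Per θ P) : PrintedCarriersR :=
  { X with
    I8a := B7Prop1Explicit.Site θ.D × Fin θ.D, I8b := IdxB8SubDPerκ θ P M₁ R, I8c := lam.base.I8c, I8d := lam.base.I8d, d8 := θ.D, L8 := θ.L,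
    C₂ := lam.base.C₂, B₁' := lam.base.B₁', B₀' := lam.base.inp.B₀', B₁ := lam.base.B₁, B₂ := lam.base.B₂, c₁ := lam.base.c₁, inp8 := lam.base.inp, B₀β := lam.base.B₀β,
    loc8 := blockPairNA θ.D θ.L θ.𝔸, fam8 := fun j => (famB8OfRecordSubBP₂DPer θ lam.base.β lam.base.len P j.1).toGFData2, lan8 := lam.base.lan, cub8 := lam.base.cub,
    toAxial8 := fun j => lam.toAxial j.1,
    C140 := fun j => (famB8OfRecordSubBP₂DPer θ lam.base.β lam.base.len P j.1).C140, InR := fun j => (famB8OfRecordSubBP₂DPer θ lam.base.β lam.base.len P j.1).InR,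
    proj140 := fun j α₂ U₀ U₁ h => proj140_famB8OfRecordSubBP₂DPer lam.base.β lam.base.len P j.1 α₂ U₀ U₁ h }

/-- ★★ **THE `b8` LEAF AT THE PERIODIC δ₂-GROUP OF RECORD ON THE PRINT-CLASS CUT, IN ITS SURVIVING FORM** (`B8LeafKnitRS.B8LeafRS`, the shape of the ∅ display) over the cut family
`famB8OfRecordSubBP₂DPer θ β len P ∘ Subtype.val` at the residual layer `lam` — N05's display on the (β′-PERIODIC) road WITH ITS INDEX IN PRINT's (1.3)–(1.4) CLASS at the pinned `(M₁, R)`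
(director-ym №220 (A-4); dag-n05-d's P4 κ-cut conclusion).  A PROPOSITION, not proved here. [cite: Balaban1985RegularSpaces, Lemma 1 p.79, Thm 2 p.83, Prop. 3 p.87, Thm 4 p.88, Prop. 5 p.94, Prop. 6 p.99, Prop. 7 p.100, Thm 8 p.101, (1.3)–(1.4) p.77; p.77 («Ω_j ⊂ T_η»)] -/
def B8LeafOfRecordSubBP₂DPerκ (θ : Stage3Params) (P M₁ R : ℕ) (lam : ResidB8Per θ P) : Prop :=
  B8LeafRS θ.D (θ.L : ℝ) lam.base.C₂ lam.base.B₁' lam.base.inp.B₀' lam.base.B₁ lam.base.B₂ lam.base.c₁ lam.base.inp lam.base.B₀β (blockPairNA θ.D θ.L θ.𝔸)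
    (fun j : IdxB8SubDPerκ θ P M₁ R => famB8OfRecordSubBP₂DPer θ lam.base.β lam.base.len P j.1) lam.base.lan lam.base.cub fun j => lam.toAxial j.1

/-- ★ **UNCUT ⇒ CUT**: the leaf at the periodic δ₂-group of record implies the leaf on the print-class cut (P2′'s `_subtype` door at `Q := Admissible134 …`; restriction of the family index).
[cite: Balaban1985RegularSpaces, Lemma 1 – Thm 8 pp.79–101, (1.3)–(1.4) p.77 (bookkeeping: restriction of the family index)] -/
theorem b8LeafOfRecordSubBP₂DPerκ_of_subBP₂DPer (lam : ResidB8Per θ P) (h : B8LeafOfRecordSubBP₂DPer θ P lam) : B8LeafOfRecordSubBP₂DPerκ θ P M₁ R lam :=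
  b8LeafOfRecordSubBP₂DPer_subtype (fun i : IdxB8SubDPer θ P => Admissible134 θ.L M₁ R i.1.1.1.1.1.k i.1.1.1.1.1.Ω) lam h

/-- The surviving leaf over the SUBSTITUTED bundle's own [B8] group IS `B8LeafOfRecordSubBP₂DPerκ θ P M₁ R lam` (`Iff.rfl`). [cite: Balaban1985RegularSpaces, Lemma 1 – Thm 8 pp.79–101 (bookkeeping)] -/
theorem b8LeafRS_withB8OfRecordSubBP₂DPerκ_iff (X : PrintedCarriersR) (θ : Stage3Params) (P M₁ R : ℕ) (lam : ResidB8Per θ P) :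
    B8LeafRS (X.withB8OfRecordSubBP₂DPerκ θ P M₁ R lam).d8 (X.withB8OfRecordSubBP₂DPerκ θ P M₁ R lam).L8 (X.withB8OfRecordSubBP₂DPerκ θ P M₁ R lam).C₂
        (X.withB8OfRecordSubBP₂DPerκ θ P M₁ R lam).B₁' (X.withB8OfRecordSubBP₂DPerκ θ P M₁ R lam).B₀' (X.withB8OfRecordSubBP₂DPerκ θ P M₁ R lam).B₁
        (X.withB8OfRecordSubBP₂DPerκ θ P M₁ R lam).B₂ (X.withB8OfRecordSubBP₂DPerκ θ P M₁ R lam).c₁ (X.withB8OfRecordSubBP₂DPerκ θ P M₁ R lam).inp8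
        (X.withB8OfRecordSubBP₂DPerκ θ P M₁ R lam).B₀β (X.withB8OfRecordSubBP₂DPerκ θ P M₁ R lam).loc8 (X.withB8OfRecordSubBP₂DPerκ θ P M₁ R lam).fam8R
        (X.withB8OfRecordSubBP₂DPerκ θ P M₁ R lam).lan8 (X.withB8OfRecordSubBP₂DPerκ θ P M₁ R lam).cub8 (X.withB8OfRecordSubBP₂DPerκ θ P M₁ R lam).toAxial8 ↔
      B8LeafOfRecordSubBP₂DPerκ θ P M₁ R lam :=
  Iff.rfl

/-- The substitution's index IS the print-class periodic cut (`rfl`). [cite: Balaban1985RegularSpaces, (1.3)–(1.4) p.77 (bookkeeping)] -/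
theorem withB8OfRecordSubBP₂DPerκ_I8b (X : PrintedCarriersR) (θ : Stage3Params) (P M₁ R : ℕ) (lam : ResidB8Per θ P) :
    (X.withB8OfRecordSubBP₂DPerκ θ P M₁ R lam).I8b = IdxB8SubDPerκ θ P M₁ R := rfl

/-- The substitution's `GFData2` family IS P1′'s periodic δ₂-model at the cut members (`rfl`). [cite: Balaban1985RegularSpaces, (1.33)–(1.40) pp.82–83 (bookkeeping)] -/
theorem withB8OfRecordSubBP₂DPerκ_fam8 (X : PrintedCarriersR) (θ : Stage3Params) (P M₁ R : ℕ) (lam : ResidB8Per θ P) :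
    (X.withB8OfRecordSubBP₂DPerκ θ P M₁ R lam).fam8 = fun j : IdxB8SubDPerκ θ P M₁ R => (zdGF3HP₂Per θ.𝔸 θ.L lam.base.β lam.base.len j.toZdIdx P).toGFData2 := rfl

/-- The substitution's re-packaged `GFData3` family `fam8R` IS the cut family (`rfl`, structure eta). [cite: Balaban1985RegularSpaces, (1.33)–(1.40) pp.82–83, (1.140) p.100 (bookkeeping)] -/
theorem withB8OfRecordSubBP₂DPerκ_fam8R (X : PrintedCarriersR) (θ : Stage3Params) (P M₁ R : ℕ) (lam : ResidB8Per θ P) :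
    (X.withB8OfRecordSubBP₂DPerκ θ P M₁ R lam).fam8R = fun j : IdxB8SubDPerκ θ P M₁ R => famB8OfRecordSubBP₂DPer θ lam.base.β lam.base.len P j.1 := rfl

/-- The substitution's axial map IS the layer's periodic axial map read on the cut (`rfl`). [cite: Balaban1985RegularSpaces, Prop. 7 p.100 (bookkeeping)] -/
theorem withB8OfRecordSubBP₂DPerκ_toAxial8 (X : PrintedCarriersR) (θ : Stage3Params) (P M₁ R : ℕ) (lam : ResidB8Per θ P) :
    (X.withB8OfRecordSubBP₂DPerκ θ P M₁ R lam).toAxial8 = fun j => lam.toAxial j.1 := rfl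

/-- The substitution does not touch the [B10] group (`rfl`) … [cite: Balaban1985UV3, (1)–(5) p.256 (bookkeeping)] -/
theorem withB8OfRecordSubBP₂DPerκ_runs10 (X : PrintedCarriersR) (θ : Stage3Params) (P M₁ R : ℕ) (lam : ResidB8Per θ P) :
    (X.withB8OfRecordSubBP₂DPerκ θ P M₁ R lam).runs10 = X.runs10 := rfl

/-- … nor the [B12 §§2–5] and [B13] groups (`rfl` ×4) … [cite: Balaban1987RG1, Lemma 4 p.280; Balaban1988RG2Cluster, Lemmas 1–3 pp.9–20 (bookkeeping)] -/
theorem withB8OfRecordSubBP₂DPerκ_F12_c12_S13_c13 (X : PrintedCarriersR) (θ : Stage3Params) (P M₁ R : ℕ) (lam : ResidB8Per θ P) :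
    (X.withB8OfRecordSubBP₂DPerκ θ P M₁ R lam).F12 = X.F12 ∧ (X.withB8OfRecordSubBP₂DPerκ θ P M₁ R lam).c12 = X.c12 ∧
      (X.withB8OfRecordSubBP₂DPerκ θ P M₁ R lam).S13 = X.S13 ∧ (X.withB8OfRecordSubBP₂DPerκ θ P M₁ R lam).c13 = X.c13 := ⟨rfl, rfl, rfl, rfl⟩

/-- … commutes with the [B10] re-binding `withRuns10` and the [B12] substitution `withB12` (`rfl` ×2) … [cite: Balaban1985UV3, (1)–(5) p.256; Balaban1987RG1, Lemma 4 p.280 (bookkeeping)] -/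
theorem withRuns10_withB12_withB8OfRecordSubBP₂DPerκ (X : PrintedCarriersR) {J : Type} (r : J → B10.RunData) (F12 : B12Sec2to5.Lemma4Frame) (c12 : B12Sec2to5.Lemma4Consts)
    (θ : Stage3Params) (P M₁ R : ℕ) (lam : ResidB8Per θ P) :
    (X.withRuns10 r).withB8OfRecordSubBP₂DPerκ θ P M₁ R lam = (X.withB8OfRecordSubBP₂DPerκ θ P M₁ R lam).withRuns10 r ∧
      (X.withB12 F12 c12).withB8OfRecordSubBP₂DPerκ θ P M₁ R lam = (X.withB8OfRecordSubBP₂DPerκ θ P M₁ R lam).withB12 F12 c12 := ⟨rfl, rfl⟩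

/-- … and passes through the Stage-3 substitutions `carriers₃` (`rfl`). [cite: Balaban1984PropagatorsII, pp.223–250 (bookkeeping)] -/
theorem carriers₃_withB8OfRecordSubBP₂DPerκ (θ₃ : Stage3Params) (X : PrintedCarriersR) (θ : Stage3Params) (P M₁ R : ℕ) (lam : ResidB8Per θ P) :
    carriers₃ θ₃ (X.withB8OfRecordSubBP₂DPerκ θ P M₁ R lam) = (carriers₃ θ₃ X).withB8OfRecordSubBP₂DPerκ θ P M₁ R lam := rfl

/-- **THE κ-PIN SUPERSEDES the ℤᵈ pin, the periodic `zdGF3Per` pin, the ℤᵈ δ₂-pin and the (uncut) periodic δ₂-pin** (`rfl` ×4: the same [B8] fields are overwritten).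
[cite: Balaban1985RegularSpaces, Lemma 1 – Thm 8 pp.79–101 (bookkeeping)] -/
theorem withB8OfRecord_all_withB8OfRecordSubBP₂DPerκ (X : PrintedCarriersR) (θ : Stage3Params) (lam₀ : ResidB8 θ) (P M₁ R : ℕ) (lam₁ lam : ResidB8Per θ P) :
    (X.withB8OfRecord θ lam₀).withB8OfRecordSubBP₂DPerκ θ P M₁ R lam = X.withB8OfRecordSubBP₂DPerκ θ P M₁ R lam ∧
      (X.withB8OfRecordPer θ P lam₁).withB8OfRecordSubBP₂DPerκ θ P M₁ R lam = X.withB8OfRecordSubBP₂DPerκ θ P M₁ R lam ∧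
      (X.withB8OfRecordSubBP₂D θ lam₀).withB8OfRecordSubBP₂DPerκ θ P M₁ R lam = X.withB8OfRecordSubBP₂DPerκ θ P M₁ R lam ∧
      (X.withB8OfRecordSubBP₂DPer θ P lam₁).withB8OfRecordSubBP₂DPerκ θ P M₁ R lam = X.withB8OfRecordSubBP₂DPerκ θ P M₁ R lam := ⟨rfl, rfl, rfl, rfl⟩

/-- ★ **NON-VACUITY OF THE PINNED INDEX**: for `1 ≤ M₁`, `θ.L ≤ R·M₁`, `0 < P`, `M₁·θ.L ∣ P` the cut index is inhabited (K1's `nonempty_idxB8SubDPerκ` — dag-n05-w2's A2 BY NAME), so the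
κ-leaf is NOT vacuously true by an empty family. [cite: Balaban1985RegularSpaces, (1.3)–(1.4) p.77, (1.131) p.99, p.77 («Ω_j ⊂ T_η»)] -/
theorem nonempty_I8b_withB8OfRecordSubBP₂DPerκ (X : PrintedCarriersR) (θ : Stage3Params) (hM₁ : 1 ≤ M₁) (hRM : θ.L ≤ R * M₁) (hP : 0 < P) (hdvd : M₁ * θ.L ∣ P)
    (lam : ResidB8Per θ P) : Nonempty (X.withB8OfRecordSubBP₂DPerκ θ P M₁ R lam).I8b :=
  nonempty_idxB8SubDPerκ θ hM₁ hRM hP hdvd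

end Bundle

/-! ## §2. The κ-pin on Stage-5 parameters (UP-SIDE), the S-binding at the pin, THE DOORS (c₁κ) ∕ (c₂κ) -/

section Pin

variable (F : T4Family) (N : ℕ) [NeZero N]

/-- **The print-class periodic δ₂-pin of a Stage-5 residual**: every run's carrier bundle with its [B8] group := the periodic δ₂-group of record on the cut `IdxB8SubDPerκ θ P M₁ R` at
`lam`; every other field unchanged. [cite: Balaban1985RegularSpaces, Lemma 1 – Thm 8 pp.79–101, (1.3)–(1.4) p.77; p.77 («Ω_j ⊂ T_η»)] -/
def Residual₅.pinB8SubBP₂DPerκ (r : Residual₅ F N) (θ : Stage3Params) (P M₁ R : ℕ) (lam : ResidB8Per θ P) : Residual₅ F N :=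
  { r with X := fun Rp => (r.X Rp).withB8OfRecordSubBP₂DPerκ θ P M₁ R lam }

/-- **The print-class periodic δ₂-pin of Stage-5 parameters** (the layer typed over the parameters' OWN Stage-3 dictionary). [cite: Balaban1985RegularSpaces, Thm 2 p.83, (1.3)–(1.4) p.77 (objects of record)] -/
def Stage5Params.pinB8SubBP₂DPerκ (θ : Stage5Params F N) (P M₁ R : ℕ) (lam : ResidB8Per θ.toStage3Params P) : Stage5Params F N :=
  { θ with res := θ.res.pinB8SubBP₂DPerκ F N θ.toStage3Params P M₁ R lam }

variable {P M₁ R : ℕ}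

/-- The pinned carrier family, unfolded (`rfl`). [cite: Balaban1985RegularSpaces, Lemma 1 – Thm 8 pp.79–101 (bookkeeping)] -/
theorem Stage5Params.pinB8SubBP₂DPerκ_X (θ : Stage5Params F N) (lam : ResidB8Per θ.toStage3Params P) (Rp : B12.RunParams) :
    (θ.pinB8SubBP₂DPerκ F N P M₁ R lam).res.X Rp = (θ.res.X Rp).withB8OfRecordSubBP₂DPerκ θ.toStage3Params P M₁ R lam := rfl

/-- The pin touches neither the Stage-3 dictionary (`rfl`) nor admissibility (`Iff.rfl`). [cite: Balaban1984PropagatorsII, pp.223–250; Balaban1983RegularityDecay, (1.6) p.572 (bookkeeping)] -/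
theorem Stage5Params.pinB8SubBP₂DPerκ_toStage3Params_admissible (θ : Stage5Params F N) (lam : ResidB8Per θ.toStage3Params P) :
    (θ.pinB8SubBP₂DPerκ F N P M₁ R lam).toStage3Params = θ.toStage3Params ∧ ((θ.pinB8SubBP₂DPerκ F N P M₁ R lam).Admissible ↔ θ.Admissible) := ⟨rfl, Iff.rfl⟩

/-- … nor the density tower (induction on `k`) … [cite: Balaban1988Convergent, (0.2) p.244 (bookkeeping)] -/
theorem densOfRecord₅_pinB8SubBP₂DPerκ (θ : Stage5Params F N) (lam : ResidB8Per θ.toStage3Params P) (p : B12.RunParams) :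
    ∀ k, densOfRecord₅ F N (θ.pinB8SubBP₂DPerκ F N P M₁ R lam) p k = densOfRecord₅ F N θ p k
  | 0 => rfl
  | k + 1 => by
    show θ.res.R p k (TrhoOfRecord F N p.K k (densOfRecord₅ F N (θ.pinB8SubBP₂DPerκ F N P M₁ R lam) p k)) =
      θ.res.R p k (TrhoOfRecord F N p.K k (densOfRecord₅ F N θ p k))
    rw [densOfRecord₅_pinB8SubBP₂DPerκ θ lam p k]

/-- … nor the machine, nor the assembled datum: THE κ-PIN IS UP-SIDE. [cite: Balaban1988Convergent, (0.2) p.244 (bookkeeping)] -/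
theorem datumOfRecord₅_pinB8SubBP₂DPerκ (θ : Stage5Params F N) (lam : ResidB8Per θ.toStage3Params P) :
    machineOfRecord₅ F N (θ.pinB8SubBP₂DPerκ F N P M₁ R lam) = machineOfRecord₅ F N θ ∧
      datumOfRecord₅ F N (θ.pinB8SubBP₂DPerκ F N P M₁ R lam) = datumOfRecord₅ F N θ := by
  have hm : machineOfRecord₅ F N (θ.pinB8SubBP₂DPerκ F N P M₁ R lam) = machineOfRecord₅ F N θ := by
    unfold machineOfRecord₅
    simp only [densOfRecord₅_pinB8SubBP₂DPerκ]
    rfl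
  refine ⟨hm, ?_⟩
  unfold datumOfRecord₅
  rw [hm]

/-- The κ-pin COMMUTES with the [B10] ∕ Y ∕ Z ∕ W pins (`rfl` ×4). [cite: Balaban1985UV3, (1)–(5) p.256; Balaban1985BackgroundPropagators, Thm 3.1 p.397; Balaban1985Variational, Thm 1 p.279; Balaban1989LargeFieldI, (0.2) p.176 (bookkeeping)] -/
theorem Stage5Params.pinB8SubBP₂DPerκ_commutes (θ : Stage5Params F N) (lam : ResidB8Per θ.toStage3Params P) (Y₀ : PrintedCarriers9X) (Z₀ : PrintedCarriers11)
    (W₀ : B12.RunParams → PrintedCarriers15) :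
    (θ.pinB8SubBP₂DPerκ F N P M₁ R lam).pinB10 F N = (θ.pinB10 F N).pinB8SubBP₂DPerκ F N P M₁ R lam ∧
      (θ.pinB8SubBP₂DPerκ F N P M₁ R lam).pinY F N Y₀ = (θ.pinY F N Y₀).pinB8SubBP₂DPerκ F N P M₁ R lam ∧
      (θ.pinB8SubBP₂DPerκ F N P M₁ R lam).pinZ F N Z₀ = (θ.pinZ F N Z₀).pinB8SubBP₂DPerκ F N P M₁ R lam ∧
      (θ.pinB8SubBP₂DPerκ F N P M₁ R lam).pinW F N W₀ = (θ.pinW F N W₀).pinB8SubBP₂DPerκ F N P M₁ R lam := ⟨rfl, rfl, rfl, rfl⟩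

/-- … and SUPERSEDES the ℤᵈ pin, the periodic pin and the uncut periodic δ₂-pin (`rfl` ×3). [cite: Balaban1985RegularSpaces, Thm 2 p.83 (bookkeeping)] -/
theorem Stage5Params.pinB8_all_pinB8SubBP₂DPerκ (θ : Stage5Params F N) (lam₀ : ResidB8 θ.toStage3Params) (lam₁ lam : ResidB8Per θ.toStage3Params P) :
    (θ.pinB8 F N lam₀).pinB8SubBP₂DPerκ F N P M₁ R lam = θ.pinB8SubBP₂DPerκ F N P M₁ R lam ∧
      (θ.pinB8Per F N P lam₁).pinB8SubBP₂DPerκ F N P M₁ R lam = θ.pinB8SubBP₂DPerκ F N P M₁ R lam ∧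
      (θ.pinB8SubBP₂DPer F N P lam₁).pinB8SubBP₂DPerκ F N P M₁ R lam = θ.pinB8SubBP₂DPerκ F N P M₁ R lam := ⟨rfl, rfl, rfl⟩

/-- The C-binding's `b9` leaf does not read the [B8] group (`rfl`; stated ALONE) … [cite: Balaban1985BackgroundPropagators, Thm 3.1 p.397 (bookkeeping)] -/
theorem upOfRecord₅C_pinB8SubBP₂DPerκ_b9 (θ : Stage5Params F N) (lam : ResidB8Per θ.toStage3Params P) (Rp : B12.RunParams) :
    (upOfRecord₅C F N (θ.pinB8SubBP₂DPerκ F N P M₁ R lam) Rp).b9 = (upOfRecord₅C F N θ Rp).b9 := rfl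

/-- … nor does `b11` (`rfl`) … [cite: Balaban1985Variational, Thm 1 p.279 (bookkeeping)] -/
theorem upOfRecord₅C_pinB8SubBP₂DPerκ_b11 (θ : Stage5Params F N) (lam : ResidB8Per θ.toStage3Params P) (Rp : B12.RunParams) :
    (upOfRecord₅C F N (θ.pinB8SubBP₂DPerκ F N P M₁ R lam) Rp).b11 = (upOfRecord₅C F N θ Rp).b11 := rfl

/-- … nor `rBasicStep` (`rfl`) … [cite: Balaban1989LargeFieldI, Prop. 1 p.194 (bookkeeping)] -/
theorem upOfRecord₅C_pinB8SubBP₂DPerκ_rBasicStep (θ : Stage5Params F N) (lam : ResidB8Per θ.toStage3Params P) (Rp : B12.RunParams) :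
    (upOfRecord₅C F N (θ.pinB8SubBP₂DPerκ F N P M₁ R lam) Rp).rBasicStep = (upOfRecord₅C F N θ Rp).rBasicStep := rfl

/-- … nor does `b10` (the compact [B10] node reads the run family only; through `carriers₃_withB8OfRecordSubBP₂DPerκ`). [cite: Balaban1985UV3, Thm 1 p.257 + Thm 2 p.272 (bookkeeping)] -/
theorem upOfRecord₅C_pinB8SubBP₂DPerκ_b10_iff (θ : Stage5Params F N) (lam : ResidB8Per θ.toStage3Params P) (Rp : B12.RunParams) :
    (upOfRecord₅C F N (θ.pinB8SubBP₂DPerκ F N P M₁ R lam) Rp).b10 ↔ (upOfRecord₅C F N θ Rp).b10 := by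
  rw [upOfRecord₅C_b10_iff, upOfRecord₅C_b10_iff, (Stage5Params.pinB8SubBP₂DPerκ_toStage3Params_admissible F N θ lam).1, Stage5Params.pinB8SubBP₂DPerκ_X,
    carriers₃_withB8OfRecordSubBP₂DPerκ]
  exact Iff.rfl

/-- ★★★ **THE DOOR (c₁κ): THE `b8` LEAF OF THE S-BINDING AT κ-PINNED PARAMETERS IS THE SURVIVING LEAF AT THE PERIODIC δ₂-GROUP OF RECORD ON THE PRINT-CLASS CUT** (`Iff.rfl` through
`carriers₃_withB8OfRecordSubBP₂DPerκ`) — N05's display `B8LeafRS` at `upOfRecord₅CS`, read with periodic δ₂-data over print's class, by name.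
[cite: Balaban1985RegularSpaces, Lemma 1 – Thm 8 pp.79–101 (the leaf at the objects of record); (1.3)–(1.4) p.77; p.77 («Ω_j ⊂ T_η»)] -/
theorem upOfRecord₅CS_pinB8SubBP₂DPerκ_b8_iff (θ : Stage5Params F N) (lam : ResidB8Per θ.toStage3Params P) (Rp : B12.RunParams) :
    (upOfRecord₅CS F N (θ.pinB8SubBP₂DPerκ F N P M₁ R lam) Rp).b8 ↔ B8LeafOfRecordSubBP₂DPerκ θ.toStage3Params P M₁ R lam :=
  Iff.rfl

/-- ★★ **THE DOOR (c₂κ), EQUATION-KEYED — FOR ANY STAGE-5 PARAMETERS WHOSE RUN-`Rp` CARRIER BUNDLE IS A κ-SUBSTITUTED ONE** (in particular the Stage-13 view `θ'.toStage5₁₃CoPH F 2` of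
`K1V9Defs.RecordSV`, whose `res.X` is the free residual field): the S-binding's `b8` leaf IS `B8LeafOfRecordSubBP₂DPerκ` — the K1 witness reaches N05's κ-cut display WITHOUT a Stage-13 pin and
WITHOUT re-keying a rung (`CarriersB8Per.upOfRecord₅CS_b8_iff_of_res_X_eq'` BY NAME). [cite: Balaban1985RegularSpaces, Lemma 1 – Thm 8 pp.79–101, (1.3)–(1.4) p.77; p.77] -/
theorem upOfRecord₅CS_b8_iff_of_res_X_eq_subBP₂DPerκ (θ : Stage5Params F N) (Rp : B12.RunParams) (X₀ : PrintedCarriersR) (lam : ResidB8Per θ.toStage3Params P)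
    (hX : θ.res.X Rp = X₀.withB8OfRecordSubBP₂DPerκ θ.toStage3Params P M₁ R lam) :
    (upOfRecord₅CS F N θ Rp).b8 ↔ B8LeafOfRecordSubBP₂DPerκ θ.toStage3Params P M₁ R lam :=
  upOfRecord₅CS_b8_iff_of_res_X_eq' F N θ Rp hX

/-- At κ-pinned parameters the carrier law (1.36) ⊂ (1.62) HOLDS, so OLD ⇒ NEW (`upOfRecord₅C` leaf AS TYPED ⇒ the S-binding's) is unconditional there.
[cite: Balaban1985RegularSpaces, (1.36) p.82, (1.62) p.87, Thm 8 p.101 (bookkeeping)] -/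
theorem upOfRecord₅CS_pinB8SubBP₂DPerκ_b8_of_b8 (θ : Stage5Params F N) (lam : ResidB8Per θ.toStage3Params P) (Rp : B12.RunParams)
    (h : (upOfRecord₅C F N (θ.pinB8SubBP₂DPerκ F N P M₁ R lam) Rp).b8) : (upOfRecord₅CS F N (θ.pinB8SubBP₂DPerκ F N P M₁ R lam) Rp).b8 :=
  upOfRecord₅CS_b8_of_upOfRecord₅C_b8 F N _ Rp (fun j b b₂ s U₀ U₁ h' => C136_C162_famB8OfRecordSubBP₂DPer lam.base.β lam.base.len P j.1 b b₂ s U₀ U₁ h') h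

/-- **UNCUT ⇒ CUT at the S-binding**: the `b8` leaf at the uncut periodic δ₂-pin implies the `b8` leaf at the κ-pin (same layer). [cite: Balaban1985RegularSpaces, Lemma 1 – Thm 8 pp.79–101, (1.3)–(1.4) p.77 (bookkeeping)] -/
theorem upOfRecord₅CS_pinB8SubBP₂DPerκ_b8_of_pinB8SubBP₂DPer_b8 (θ : Stage5Params F N) (lam : ResidB8Per θ.toStage3Params P) (Rp : B12.RunParams)
    (h : (upOfRecord₅CS F N (θ.pinB8SubBP₂DPer F N P lam) Rp).b8) : (upOfRecord₅CS F N (θ.pinB8SubBP₂DPerκ F N P M₁ R lam) Rp).b8 :=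
  (upOfRecord₅CS_pinB8SubBP₂DPerκ_b8_iff F N θ lam Rp).2
    (b8LeafOfRecordSubBP₂DPerκ_of_subBP₂DPer lam ((upOfRecord₅CS_pinB8SubBP₂DPer_b8_iff F N θ P lam Rp).1 h))

end Pin

/-! ## §3. Sub-family doors of the κ-leaf, the projections the chain feeds, Proposition 3 at the cut -/

section SubFamily

variable {θ : Stage3Params} {P M₁ R : ℕ}

/-- **THE κ-LEAF PASSES TO SUB-FAMILIES** (restriction along any `e : J → IdxB8SubDPerκ θ P M₁ R` — e.g. a larger `R′ ↦ R` through `ofLE`, or a deeper cut): P2′'s `_precomp` door at `val ∘ e`.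
[cite: Balaban1985RegularSpaces, Lemma 1 – Thm 8 pp.79–101 (bookkeeping: restriction of the family index)] -/
theorem b8LeafOfRecordSubBP₂DPerκ_precomp {J : Type} (e : J → IdxB8SubDPerκ θ P M₁ R) (lam : ResidB8Per θ P) (h : B8LeafOfRecordSubBP₂DPerκ θ P M₁ R lam) :
    B8LeafRS θ.D (θ.L : ℝ) lam.base.C₂ lam.base.B₁' lam.base.inp.B₀' lam.base.B₁ lam.base.B₂ lam.base.c₁ lam.base.inp lam.base.B₀β (blockPairNA θ.D θ.L θ.𝔸)
      (fun j => famB8OfRecordSubBP₂DPer θ lam.base.β lam.base.len P (e j).1) lam.base.lan lam.base.cub (fun j => lam.toAxial (e j).1) where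
  l1 := h.l1
  t2 := B8LeafKnit.thm2Printed_precomp e (fun j : IdxB8SubDPerκ θ P M₁ R => (famB8OfRecordSubBP₂DPer θ lam.base.β lam.base.len P j.1).toGFData) h.t2
  p3 := B8LeafKnit.prop3Printed_precomp e θ.D (θ.L : ℝ) lam.base.C₂ lam.base.inp lam.base.B₀β
    (fun j : IdxB8SubDPerκ θ P M₁ R => (famB8OfRecordSubBP₂DPer θ lam.base.β lam.base.len P j.1).toGFData2) h.p3
  t4 := B8LeafKnit.thm4Printed_precomp e lam.base.B₁' (fun j : IdxB8SubDPerκ θ P M₁ R => (famB8OfRecordSubBP₂DPer θ lam.base.β lam.base.len P j.1).toGFData) h.t4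
  p5e := h.p5e
  p5u := h.p5u
  p6 := h.p6
  p7 := B8LeafKnit.prop7PrintedR_precomp e (fun j : IdxB8SubDPerκ θ P M₁ R => famB8OfRecordSubBP₂DPer θ lam.base.β lam.base.len P j.1) (fun j => lam.toAxial j.1) h.p7
  t8 := B8Thm8Surviving.thm8SurvivingAt_precomp e 1 lam.base.B₁ lam.base.B₂ (fun j : IdxB8SubDPerκ θ P M₁ R => famB8OfRecordSubBP₂DPer θ lam.base.β lam.base.len P j.1) h.t8

/-- «R sufficiently large»: the κ-leaf at `R` gives the κ-leaf at every `R′ ≥ R`… precisely, along `ofLE : IdxB8SubDPerκ θ P M₁ R′ → IdxB8SubDPerκ θ P M₁ R` for `R ≤ R′` the leaf at the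
LARGER class (smaller `R`) restricts to the smaller class (larger `R′`). [cite: Balaban1985RegularSpaces, (1.4) p.77 («R is a sufficiently large positive integer»)] -/
theorem b8LeafOfRecordSubBP₂DPerκ_mono_R {R' : ℕ} (hR : R ≤ R') (lam : ResidB8Per θ P) (h : B8LeafOfRecordSubBP₂DPerκ θ P M₁ R lam) :
    B8LeafOfRecordSubBP₂DPerκ θ P M₁ R' lam :=
  b8LeafOfRecordSubBP₂DPerκ_precomp (fun j : IdxB8SubDPerκ θ P M₁ R' => j.ofLE hR) lam h

/-- Theorem 2's conjunct over the cut family, projected (the target shape of dag-n05-c's transfer′ at `ι := IdxB8SubDPerκ.toZdIdx`). [cite: Balaban1985RegularSpaces, Thm 2 p.83] -/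
theorem b8LeafOfRecordSubBP₂DPerκ_t2 (lam : ResidB8Per θ P) (h : B8LeafOfRecordSubBP₂DPerκ θ P M₁ R lam) :
    B8.Thm2Printed (fun j : IdxB8SubDPerκ θ P M₁ R => (famB8OfRecordSubBP₂DPer θ lam.base.β lam.base.len P j.1).toGFData) :=
  h.t2

/-- Theorem 4's conjunct over the cut family, projected. [cite: Balaban1985RegularSpaces, Thm 4 p.88] -/
theorem b8LeafOfRecordSubBP₂DPerκ_t4 (lam : ResidB8Per θ P) (h : B8LeafOfRecordSubBP₂DPerκ θ P M₁ R lam) :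
    B8.Thm4Printed lam.base.B₁' (fun j : IdxB8SubDPerκ θ P M₁ R => (famB8OfRecordSubBP₂DPer θ lam.base.β lam.base.len P j.1).toGFData) :=
  h.t4

/-- Theorem 8's surviving conjunct over the cut family, projected. [cite: Balaban1985RegularSpaces, Thm 8 (1.146) p.101] -/
theorem b8LeafOfRecordSubBP₂DPerκ_t8 (lam : ResidB8Per θ P) (h : B8LeafOfRecordSubBP₂DPerκ θ P M₁ R lam) :
    B8Thm8Surviving.Thm8SurvivingAt 1 lam.base.B₁ lam.base.B₂ (fun j : IdxB8SubDPerκ θ P M₁ R => famB8OfRecordSubBP₂DPer θ lam.base.β lam.base.len P j.1) :=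
  h.t8

/-- ★ **PROPOSITION 3 AT THE CUT PERIODIC δ₂-FAMILY**, modulo dag-n06-b's BOTH-POINTS socket `SockB9P3H2` at print's class `towerBondsP` AT THE CUT MEMBERS ONLY (P2′'s `prop3_famB8OfRecordSubBP₂DPer`
along `Subtype.val`; dag-n05-d's D3₂ BY NAME): `θ.D ≥ 2`, `C₂ ≥ 2097152(d+1)²L²`, `B₀(β₀) ≥ 0`. [cite: Balaban1985RegularSpaces, Prop. 3 p.87, (1.3)–(1.4) p.77; Balaban1985BackgroundPropagators, Thm 3.3 p.399, (3.40) p.397] -/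
theorem prop3_famB8OfRecordSubBP₂DPerκ (hD : 2 ≤ θ.D) (inp : B8.B9Inputs) {B₀β C₂ cP : ℝ} (hB₀β : 0 ≤ B₀β) (hC₂ : 2097152 * ((θ.D : ℝ) + 1) ^ 2 * (θ.L : ℝ) ^ 2 ≤ C₂)
    (hcP : 0 < cP) (β : ℝ) (len : B7Prop1Explicit.Site θ.D → ℝ)
    (SB9P : ∀ j : IdxB8SubDPerκ θ P M₁ R, SockB9P3H2 (𝔸 := θ.𝔸) θ.L inp.B₀ B₀β cP β len j.toZdIdx.η j.toZdIdx.k j.toZdIdx.Ω j.toZdIdx.Λs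
      (fun m l => towerBondsP θ.L j.toZdIdx.Ω (j.toZdIdx.Λs m) l)) :
    B8.Prop3Printed θ.D (θ.L : ℝ) C₂ inp B₀β (fun j : IdxB8SubDPerκ θ P M₁ R => (famB8OfRecordSubBP₂DPer θ β len P j.1).toGFData2) :=
  prop3Printed_famB8OfRecordSubBP₂DPer_of_subBP₂D (fun j : IdxB8SubDPerκ θ P M₁ R => j.1) β len
    (B8Prop3PrintedZdGF3P2Gamma.prop3Printed_zdGF3P₂_map_γ hD θ.two_le_L inp hB₀β hC₂ hcP β len (fun j : IdxB8SubDPerκ θ P M₁ R => j.toZdIdx) SB9P)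

end SubFamily

end Literature.MathematicalPhysics.QuantumFieldTheory.Balaban1983to89.Node00

end
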